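import Mathlib
import Literature.Combinatorics.Enumerative.InvolutionsAvoiding4321
import HarnessLib

/-!
# Involutions avoiding `4321` and `132`: `|I_n(4321, 132)| = |I_n(4321, 213)| = 1 + ⌊n/2⌋·⌈n/2⌉` (Barnabei–Bonetti–Silimbani 2011, Theorem 5 (i) / Corollary 6 (i))

Layer `Literature/Combinatorics/Enumerative`, namespace `Literature.Combinatorics.Enumerative.PermContainsPattern`; lane
`lit-hodgefound` (prover seat p13, generation 39, theme «nonnesting / noncrossing matchings and restricted
involutions»).  Sequel of `InvolutionsAvoiding4321.lean` (THEOREM 2 on arcs: an involution avoids `4321` iff no two of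
its arcs nest).

## Source

M. Barnabei, F. Bonetti, M. Silimbani, *Restricted involutions and Motzkin paths*, Adv. Appl. Math. **47** (2011)
102–115 = arXiv:0812.0463 [BarnabeiBonettiSilimbani2011] (held text `paper-arxiv-0812.0463`, arXiv numbering, §4):

> **Theorem 5.** Let `τ` be an involution in `I_n(4321)` associated with the labelled Motzkin path `(M, υ)`. Then:
> i. `τ` avoids `132` if and only if `M` does not contain any subpath among `HU`, `DU` and `DHD`. As a consequence,
> `τ` avoids `213` if and only if `M` does not contain any subpath among `DH`, `DU` and `UHU`; …
> [proof] If `M` does not contain any of those subpaths, then `M = U^a H^b D^a H^c` for suited non-negative integers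
> `a, b, c` such that `2a + b + c = n`.
> **Corollary 6.** We have: i. `|I_n(4321,132)| = |I_n(4321,213)| = 1 + ⌊n/2⌋⌈n/2⌉` …
> [proof] The cardinality of `I_n(4321,132)` equals the number of Motzkin paths of the kind `M = U^a H^b D^a H^c`.
> Hence, we have: `|I_n(4321,132)| = 1 + Σ_{h=1}^{⌊n/2⌋} (n − 2h + 1) = 1 + ⌊n/2⌋⌈n/2⌉`.
> «Formulas i. and iii., up to our knowledge, are new.»

## Formalisation (arc language)

* §1 The path `U^a H^b D^a H^c` as a permutation: `blockArc n a b` (for `2a + b ≤ n`) sends `y ↦ y + a + b` for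
  `y < a`, `y ↦ y − a − b` for `a + b ≤ y < 2a + b`, and fixes the rest (definitions `blockArcFun`, `blockArc`;
  `blockArc_val`); it is an involution avoiding `4321` and `132` (`blockArc_mem`).
* §2 THEOREM 5 (i) on arcs: in an involution avoiding `132` every letter before an opener is an opener
  (`openersFirst_of_not_contains_132`: a fixed point or closer `k'` before an opener `k` gives the occurrence
  `u k', u k, k`); with nonnesting arcs the partners of the openers increase (`apply_lt_apply_of_nonnesting`) and no
  fixed point separates two closers (`closer_of_between_closers`: `DHD` gives `u c, f, u c'`), so the closers are
  consecutive and ★★ `eq_blockArc`: `u = blockArc n a b` with `a` the number of openers and `a + b = u 0`.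
* §3 ★★★ COROLLARY 6 (i): `card_involutions_av4321_av132 : |I_n(4321, 132)| = 1 + (n/2)·(n − n/2)`, by the bijection
  with the parameters `(a, b)`, `a = 0 ∧ b = 0` or `1 ≤ a`, `2a + b ≤ n` (`card_params`), and
  `card_involutions_av4321_av213` by the reverse–complement.
-/

namespace Literature.Combinatorics.Enumerative

namespace PermContainsPattern

open Finset Equiv

variable {n : ℕ}

/-! ### §1 The involution `U^a H^b D^a H^c` -/

/-- The underlying function of `U^a H^b D^a H^c`: `y ↦ y + a + b` (`y < a`), `y ↦ y − (a + b)` (`a + b ≤ y < 2a + b`),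
`y ↦ y` otherwise. [cite: BarnabeiBonettiSilimbani2011, Theorem 5 (i) (proof; arXiv 0812.0463)] -/
def blockArcFun (n a b : ℕ) (h : 2 * a + b ≤ n) (y : Fin n) : Fin n :=
  if h₁ : (y : ℕ) < a then ⟨y + a + b, by omega⟩
  else if a + b ≤ (y : ℕ) ∧ (y : ℕ) < 2 * a + b then ⟨y - (a + b), by omega⟩ else y

/-- Its values. [cite: BarnabeiBonettiSilimbani2011, Theorem 5 (i) (arXiv 0812.0463)] -/
theorem blockArcFun_val (n a b : ℕ) (h : 2 * a + b ≤ n) (y : Fin n) :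
    ((blockArcFun n a b h y : Fin n) : ℕ) =
      if (y : ℕ) < a then (y : ℕ) + a + b else if a + b ≤ (y : ℕ) ∧ (y : ℕ) < 2 * a + b then (y : ℕ) - (a + b)
        else (y : ℕ) := by
  unfold blockArcFun
  split_ifs <;> rfl

/-- `U^a H^b D^a H^c` is an involution (as a function). [cite: BarnabeiBonettiSilimbani2011, Theorem 5 (i) (arXiv 0812.0463)] -/
theorem blockArcFun_involutive (n a b : ℕ) (h : 2 * a + b ≤ n) : Function.Involutive (blockArcFun n a b h) := by
  intro y
  apply Fin.ext
  rw [blockArcFun_val, blockArcFun_val]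
  split_ifs <;> omega

/-- **The involution `U^a H^b D^a H^c`** of `[n]` (`2a + b ≤ n`, `c = n − 2a − b`): the arcs `(y, y + a + b)`, `y < a`.
[cite: BarnabeiBonettiSilimbani2011, Theorem 5 (i) and Corollary 6 (i) (arXiv 0812.0463)] -/
def blockArc (n a b : ℕ) (h : 2 * a + b ≤ n) : Perm (Fin n) :=
  (blockArcFun_involutive n a b h).toPerm _

/-- Values of `blockArc`. [cite: BarnabeiBonettiSilimbani2011, Theorem 5 (i) (arXiv 0812.0463)] -/
theorem blockArc_val (n a b : ℕ) (h : 2 * a + b ≤ n) (y : Fin n) :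
    ((blockArc n a b h y : Fin n) : ℕ) =
      if (y : ℕ) < a then (y : ℕ) + a + b else if a + b ≤ (y : ℕ) ∧ (y : ℕ) < 2 * a + b then (y : ℕ) - (a + b)
        else (y : ℕ) := by
  rw [blockArc, Function.Involutive.coe_toPerm, blockArcFun_val]

/-- `blockArc` is an involution. [cite: BarnabeiBonettiSilimbani2011, Theorem 5 (i) (arXiv 0812.0463)] -/
theorem blockArc_apply_apply (n a b : ℕ) (h : 2 * a + b ≤ n) (y : Fin n) :
    blockArc n a b h (blockArc n a b h y) = y := by
  rw [blockArc, Function.Involutive.coe_toPerm]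
  exact blockArcFun_involutive n a b h y

/-- The openers of `blockArc n a b` are the letters `< a`. [cite: BarnabeiBonettiSilimbani2011, Theorem 5 (i) (arXiv 0812.0463)] -/
theorem lt_blockArc_iff (n a b : ℕ) (h : 2 * a + b ≤ n) (y : Fin n) : y < blockArc n a b h y ↔ (y : ℕ) < a := by
  rw [Fin.lt_def, blockArc_val]
  split_ifs <;> omega

/-- ★ `blockArc n a b` is an involution avoiding `4321` and `132`. [cite: BarnabeiBonettiSilimbani2011, Theorem 5 (i) (arXiv 0812.0463)] -/
theorem blockArc_mem (n a b : ℕ) (h : 2 * a + b ≤ n) :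
    blockArc n a b h * blockArc n a b h = 1 ∧ ¬ PermContainsPattern (blockArc n a b h) ![4, 3, 2, 1] ∧
      ¬ PermContainsPattern (blockArc n a b h) ![1, 3, 2] := by
  have hu : ∀ y, blockArc n a b h (blockArc n a b h y) = y := blockArc_apply_apply n a b h
  refine ⟨(mul_self_eq_one_iff_apply_apply _).2 hu, (not_contains_4321_iff_nonnesting hu).2 fun i j hij hj hji => ?_,
    fun h132 => ?_⟩
  · have h1 := Fin.lt_def.1 hij; have h2 := Fin.lt_def.1 hj; have h3 := Fin.lt_def.1 hji
    rw [blockArc_val] at h2 h3; rw [blockArc_val n a b h i] at h3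
    split_ifs at h2 h3 <;> omega
  · obtain ⟨x, y, z, hxy, hyz, h1, h2⟩ := (contains_132_iff _).1 h132
    have e1 := Fin.lt_def.1 hxy; have e2 := Fin.lt_def.1 hyz; have e3 := Fin.lt_def.1 h1; have e4 := Fin.lt_def.1 h2
    rw [blockArc_val, blockArc_val] at e3 e4
    split_ifs at e3 e4 <;> omega

/-! ### §2 THEOREM 5 (i) on arcs: every `4321`- and `132`-avoiding involution is a `blockArc` -/

/-- In an involution avoiding `132`, every letter before an opener is an opener: a fixed point or a closer `k'` before
an opener `k` gives the occurrence `u k', u k, k` of `132` at `k' < k < u k` («HU», «DU»).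
[cite: BarnabeiBonettiSilimbani2011, Theorem 5 (i), cases 1–2 (arXiv 0812.0463)] -/
theorem openersFirst_of_not_contains_132 {u : Perm (Fin n)} (hu : ∀ x, u (u x) = x)
    (h : ¬ PermContainsPattern u ![1, 3, 2]) {k' k : Fin n} (hk'k : k' < k) (hk : k < u k) : k' < u k' := by
  by_contra hle
  refine h ((contains_132_iff u).2 ⟨k', k, u k, hk'k, hk, ?_, ?_⟩)
  · rw [hu]; exact lt_of_le_of_lt (not_lt.1 hle) hk'k
  · rw [hu]; exact hk

/-- With nonnesting arcs and the openers first, the partners of the openers increase.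
[cite: BarnabeiBonettiSilimbani2011, Theorem 2 and Theorem 5 (i) (arXiv 0812.0463)] -/
theorem apply_lt_apply_of_nonnesting {u : Perm (Fin n)} (hu : ∀ x, u (u x) = x)
    (hnn : ∀ i j : Fin n, i < j → j < u j → u j < u i → False) (h132 : ¬ PermContainsPattern u ![1, 3, 2])
    {x y : Fin n} (hxy : x < y) (hy : y < u y) : u x < u y := by
  have hx : x < u x := openersFirst_of_not_contains_132 hu h132 hxy hy
  rcases lt_trichotomy (u x) (u y) with hlt | heq | hgt
  · exact hlt
  · exact absurd (u.injective heq) (ne_of_lt hxy)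
  · exact (hnn x y hxy hy hgt).elim

/-- No fixed point lies between two closers («DHD»: the closers `c < c'` and a fixed point `f` between them give the
occurrence `u c, f, u c'` of `132`). [cite: BarnabeiBonettiSilimbani2011, Theorem 5 (i), case 3 (arXiv 0812.0463)] -/
theorem not_fixed_between_closers {u : Perm (Fin n)} (hu : ∀ x, u (u x) = x)
    (hnn : ∀ i j : Fin n, i < j → j < u j → u j < u i → False) (h132 : ¬ PermContainsPattern u ![1, 3, 2])
    {c f c' : Fin n} (hcf : c < f) (hfc' : f < c') (hc : u c < c) (hc' : u c' < c') (hf : u f = f) : False := by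
  -- `u c < u c'` (their openers in order) and `u c' < f` (an opener after the non-opener `f` is impossible)
  have hcc' : u c < u c' := by
    by_contra hle
    rcases (not_lt.1 hle).lt_or_eq with hlt | heq
    · have := apply_lt_apply_of_nonnesting hu hnn h132 hlt (by rw [hu]; exact hc)
      rw [hu, hu] at this
      exact lt_asymm (hcf.trans hfc') this
    · exact absurd (u.injective heq) (ne_of_gt (hcf.trans hfc'))
  have hc'f : u c' < f := by
    by_contra hle
    rcases (not_lt.1 hle).lt_or_eq with hlt | heq
    · have := openersFirst_of_not_contains_132 hu h132 hlt (by rw [hu]; exact hc')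
      rw [hf] at this
      exact lt_irrefl _ this
    · have h' : u f = c' := by rw [heq, hu]
      rw [hf] at h'
      exact absurd h' (ne_of_lt hfc')
  exact h132 ((contains_132_iff u).2 ⟨c, f, c', hcf, hfc', hcc', by rw [hf]; exact hc'f⟩)

/-- In an involution avoiding `132`, the openers form an initial segment: `y` is an opener iff `y < a`, `a` the
number of openers. [cite: BarnabeiBonettiSilimbani2011, Theorem 5 (i) («`M = U^a H^b D^a H^c`»; arXiv 0812.0463)] -/
theorem lt_apply_iff_lt_card {u : Perm (Fin n)} (hu : ∀ x, u (u x) = x) (h132 : ¬ PermContainsPattern u ![1, 3, 2])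
    (y : Fin n) : y < u y ↔ (y : ℕ) < (univ.filter fun z : Fin n => z < u z).card := by
  constructor
  · intro hy
    have hsub : Iic y ⊆ univ.filter fun z : Fin n => z < u z := fun z hz => by
      rw [mem_Iic] at hz
      rcases hz.lt_or_eq with hlt | rfl
      · exact mem_filter.2 ⟨mem_univ _, openersFirst_of_not_contains_132 hu h132 hlt hy⟩
      · exact mem_filter.2 ⟨mem_univ _, hy⟩
    have := card_le_card hsub
    rw [Fin.card_Iic] at this
    omega
  · intro hlt
    by_contra hy
    have hsub : (univ.filter fun z : Fin n => z < u z) ⊆ Iio y := fun z hz => by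
      rw [mem_Iio]
      by_contra hzy
      rcases (not_lt.1 hzy).lt_or_eq with h' | rfl
      · exact hy (openersFirst_of_not_contains_132 hu h132 h' (mem_filter.1 hz).2)
      · exact hy (mem_filter.1 hz).2
    have := card_le_card hsub
    rw [Fin.card_Iio] at this
    omega

/-- ★★ **THEOREM 5 (i) on arcs: every involution avoiding `4321` and `132` is `U^a H^b D^a H^c`** — with `a` its
number of openers and, when `a ≥ 1`, `a + b = u 0`: the partners of the openers `0, …, a−1` increase and are
consecutive. [cite: BarnabeiBonettiSilimbani2011, Theorem 5 (i) (arXiv 0812.0463)] -/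
theorem eq_blockArc {u : Perm (Fin n)} (hu : ∀ x, u (u x) = x) (h4321 : ¬ PermContainsPattern u ![4, 3, 2, 1])
    (h132 : ¬ PermContainsPattern u ![1, 3, 2]) :
    ∃ (a b : ℕ) (h : 2 * a + b ≤ n), (a = 0 → b = 0) ∧ u = blockArc n a b h := by
  have hnn := (not_contains_4321_iff_nonnesting hu).1 h4321
  set a := (univ.filter fun z : Fin n => z < u z).card with ha
  have hop : ∀ y : Fin n, y < u y ↔ (y : ℕ) < a := lt_apply_iff_lt_card hu h132
  by_cases ha0 : a = 0
  · -- no opener: `u = 1 = blockArc n 0 0`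
    have hfix : ∀ y : Fin n, u y = y := by
      intro y
      rcases lt_trichotomy y (u y) with h | h | h
      · exact absurd ((hop y).1 h) (by omega)
      · exact h.symm
      · have := (hop (u y)).1 (by rw [hu]; exact h)
        omega
    refine ⟨0, 0, by omega, fun _ => rfl, Equiv.ext fun y => Fin.ext ?_⟩
    rw [blockArc_val, hfix]
    split_ifs <;> omega
  · -- `a ≥ 1`: the openers are `0, …, a−1`, with partners `u y = u 0 + y`
    have hn : 0 < n := by
      have : a ≤ (univ : Finset (Fin n)).card := card_le_card (filter_subset _ _)
      rw [card_univ, Fintype.card_fin] at this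
      omega
    set m : ℕ := (u ⟨0, hn⟩ : ℕ) with hm
    have hstep : ∀ y : Fin n, (y : ℕ) < a → ((u y : Fin n) : ℕ) = m + y := by
      intro y
      induction hy' : (y : ℕ) generalizing y with
      | zero => intro _; rw [hm, show y = ⟨0, hn⟩ from Fin.ext hy', add_zero]
      | succ k ih =>
        intro hk
        set y' : Fin n := ⟨k, by omega⟩ with hy'def
        have hy'op : y' < u y' := (hop y').2 (show k < a by omega)
        have hyop : y < u y := (hop y).2 (by rw [hy']; exact hk)
        have hlt : y' < y := Fin.lt_def.2 (show k < (y : ℕ) by omega)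
        have h1 : u y' < u y := apply_lt_apply_of_nonnesting hu hnn h132 hlt hyop
        have ihy' : ((u y' : Fin n) : ℕ) = m + k := ih y' rfl (by omega)
        -- `u y = u y' + 1`: otherwise the letter `u y' + 1` between the closers `u y'`, `u y` is a closer whose opener
        -- lies strictly between `y'` and `y`
        have h1v := Fin.lt_def.1 h1
        by_contra hne
        have hlt2 : ((u y' : Fin n) : ℕ) + 1 < ((u y : Fin n) : ℕ) := by omega
        set f : Fin n := ⟨((u y' : Fin n) : ℕ) + 1, by omega⟩ with hfdef
        have hf1 : u y' < f := Fin.lt_def.2 (show ((u y' : Fin n) : ℕ) < ((u y' : Fin n) : ℕ) + 1 by omega)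
        have hf2 : f < u y := Fin.lt_def.2 (show ((u y' : Fin n) : ℕ) + 1 < ((u y : Fin n) : ℕ) from hlt2)
        have hcy' : u (u y') < u y' := by rw [hu]; exact hy'op
        have hcy : u (u y) < u y := by rw [hu]; exact hyop
        rcases lt_trichotomy f (u f) with hfo | hff | hfc
        · -- `f` an opener after the closer `u y'`: impossible
          have := openersFirst_of_not_contains_132 hu h132 hf1 hfo
          rw [hu] at this
          exact lt_asymm hy'op this
        · exact not_fixed_between_closers hu hnn h132 hf1 hf2 hcy' hcy hff.symm
        · -- `f` a closer: its opener `u f` lies strictly between `y'` and `y`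
          have hpo : u f < u (u f) := by rw [hu]; exact hfc
          have hq1 : y' < u f := by
            by_contra hle
            rcases (not_lt.1 hle).lt_or_eq with hlt' | heq
            · have := apply_lt_apply_of_nonnesting hu hnn h132 hlt' hy'op
              rw [hu] at this
              exact lt_asymm hf1 this
            · have e : f = u y' := by rw [← heq, hu]
              rw [← e] at hf1
              exact lt_irrefl _ hf1
          have hq2 : u f < y := by
            by_contra hle
            rcases (not_lt.1 hle).lt_or_eq with hlt' | heq
            · have := apply_lt_apply_of_nonnesting hu hnn h132 hlt' hpo
              rw [hu] at this
              exact lt_asymm hf2 this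
            · have e : u y = f := by rw [heq, hu]
              rw [e] at hf2
              exact lt_irrefl _ hf2
          have e1 := Fin.lt_def.1 hq1
          have e2 := Fin.lt_def.1 hq2
          change k < _ at e1
          omega
    -- `m ≥ a` and `m + a ≤ n`
    have hma : a ≤ m := by
      by_contra hlt
      have h0op : (⟨0, hn⟩ : Fin n) < u ⟨0, hn⟩ := (hop _).2 (show 0 < a by omega)
      have : u ⟨0, hn⟩ < u (u ⟨0, hn⟩) := (hop _).2 (by rw [← hm]; omega)
      rw [hu] at this
      exact lt_asymm h0op this
    have hmn : m + a ≤ n := by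
      have h1 := hstep ⟨a - 1, by omega⟩ (show a - 1 < a by omega)
      have hlt := (u ⟨a - 1, by omega⟩).2
      change _ = m + (a - 1) at h1
      omega
    refine ⟨a, m - a, by omega, fun h => absurd h ha0, Equiv.ext fun y => Fin.ext ?_⟩
    rw [blockArc_val]
    split_ifs with hy1 hy2
    · rw [hstep y hy1]; omega
    · -- a closer: `y = u y₀` with `y₀ = y − m < a`
      obtain ⟨hy2a, hy2b⟩ := hy2
      have h1 := hstep ⟨(y : ℕ) - m, by omega⟩ (show (y : ℕ) - m < a by omega)
      change _ = m + ((y : ℕ) - m) at h1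
      have e : u ⟨(y : ℕ) - m, by omega⟩ = y := Fin.ext (by rw [h1]; omega)
      have h2 : u y = ⟨(y : ℕ) - m, by omega⟩ := by
        have h3 := congrArg u e
        rw [hu] at h3
        exact h3.symm
      rw [h2]
      change (y : ℕ) - m = _
      omega
    · -- a fixed point: not an opener, not a closer
      rcases lt_trichotomy y (u y) with h | h | h
      · exact absurd ((hop y).1 h) hy1
      · exact congrArg Fin.val h.symm
      · have hyo : (((u y) : Fin n) : ℕ) < a := (hop (u y)).1 (by rw [hu]; exact h)
        have := hstep (u y) hyo
        rw [hu] at this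
        omega

/-! ### §3 COROLLARY 6 (i): the count -/

/-- The number of openers of `blockArc n a b` is `a`. [cite: BarnabeiBonettiSilimbani2011, Corollary 6 (i) (arXiv 0812.0463)] -/
theorem card_openers_blockArc (n a b : ℕ) (h : 2 * a + b ≤ n) :
    (univ.filter fun z : Fin n => z < blockArc n a b h z).card = a := by
  rw [filter_congr (fun z _ => lt_blockArc_iff n a b h z), Fin.card_filter_val_lt]
  omega

/-- The first letter of `blockArc n a b` (`a ≥ 1`) goes to `a + b`. [cite: BarnabeiBonettiSilimbani2011, Corollary 6 (i) (arXiv 0812.0463)] -/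
theorem blockArc_zero_val (n a b : ℕ) (h : 2 * a + b ≤ n) (ha : 0 < a) :
    ((blockArc n a b h ⟨0, by omega⟩ : Fin n) : ℕ) = a + b := by
  rw [blockArc_val]
  simp only [ha, if_true]
  omega

/-- `Σ_{a < q} (n − 2a − 1) = q (n − q)` for `2q ≤ n` (the row sums of the parameter count). [folklore] -/
private theorem sum_range_sub_two_mul (n q : ℕ) (hq : 2 * q ≤ n) :
    ∑ a ∈ range q, (n - 2 * a - 1) = q * (n - q) := by
  induction q with
  | zero => simp
  | succ q ih =>
    rw [sum_range_succ, ih (by omega)]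
    obtain ⟨s, rfl⟩ : ∃ s, n = 2 * q + 2 + s := ⟨n - 2 * q - 2, by omega⟩
    rw [show 2 * q + 2 + s - q = q + 2 + s by omega, show 2 * q + 2 + s - 2 * q - 1 = s + 1 by omega,
      show 2 * q + 2 + s - (q + 1) = q + 1 + s by omega]
    ring

/-- The parameters `(a, b)`: `a = b = 0`, or `1 ≤ a` and `2a + b ≤ n`; there are `1 + Σ_{a=1}^{⌊n/2⌋} (n − 2a + 1)
= 1 + ⌊n/2⌋ (n − ⌊n/2⌋)` of them. [cite: BarnabeiBonettiSilimbani2011, Corollary 6 (i) (proof; arXiv 0812.0463)] -/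
theorem card_params (n : ℕ) :
    (((range (n / 2 + 1)) ×ˢ (range (n + 1))).filter fun p : ℕ × ℕ => 2 * p.1 + p.2 ≤ n ∧ (p.1 = 0 → p.2 = 0)).card =
      1 + (n / 2) * (n - n / 2) := by
  rw [card_filter, sum_product, sum_range_succ', add_comm]
  congr 1
  · rw [← card_filter]
    rw [show (range (n + 1)).filter (fun b => 2 * 0 + b ≤ n ∧ (0 = 0 → b = 0)) = {0} from
      Finset.ext fun b => by
        simp only [mem_filter, mem_range, mem_singleton]
        constructor
        · rintro ⟨-, -, h⟩; exact h (by trivial)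
        · rintro rfl; exact ⟨by omega, by omega, fun _ => by trivial⟩]
    rfl
  · rw [← sum_range_sub_two_mul n (n / 2) (Nat.mul_div_le n 2)]
    refine sum_congr rfl fun a ha => ?_
    rw [mem_range] at ha
    rw [← card_filter, show (range (n + 1)).filter (fun b => 2 * (a + 1) + b ≤ n ∧ (a + 1 = 0 → b = 0)) =
      range (n - 2 * a - 1) from Finset.ext fun b => by
        simp only [mem_filter, mem_range]
        constructor
        · rintro ⟨-, h, -⟩; omega
        · intro h; exact ⟨by omega, by omega, fun h' => by omega⟩, card_range]

/-- ★★★ **COROLLARY 6 (i) (Barnabei–Bonetti–Silimbani): `|I_n(4321, 132)| = 1 + ⌊n/2⌋·⌈n/2⌉`** («up to our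
knowledge, new»), as `1 + (n/2)·(n − n/2)`: the involutions avoiding `4321` and `132` are the `blockArc n a b`,
bijectively in the parameters. [cite: BarnabeiBonettiSilimbani2011, Corollary 6 (i) (arXiv 0812.0463)] -/
theorem card_involutions_av4321_av132 (n : ℕ) :
    Nat.card {u : Perm (Fin n) // u * u = 1 ∧ ¬ PermContainsPattern u ![4, 3, 2, 1] ∧
      ¬ PermContainsPattern u ![1, 3, 2]} = 1 + (n / 2) * (n - n / 2) := by
  rw [← card_params n, ← Nat.card_eq_finsetCard]
  symm
  refine Nat.card_congr (Equiv.ofBijective (fun p : {p : ℕ × ℕ // p ∈ ((range (n / 2 + 1)) ×ˢ (range (n + 1))).filter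
      fun p : ℕ × ℕ => 2 * p.1 + p.2 ≤ n ∧ (p.1 = 0 → p.2 = 0)} =>
    (⟨blockArc n p.1.1 p.1.2 (mem_filter.1 p.2).2.1, blockArc_mem n p.1.1 p.1.2 _⟩ :
      {u : Perm (Fin n) // u * u = 1 ∧ ¬ PermContainsPattern u ![4, 3, 2, 1] ∧ ¬ PermContainsPattern u ![1, 3, 2]}))
    ⟨?_, ?_⟩)
  · -- injective: `a` = number of openers, `b = u 0 − a` (or `0`)
    rintro ⟨⟨a, b⟩, hp⟩ ⟨⟨a', b'⟩, hp'⟩ heq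
    have hab := (mem_filter.1 hp).2
    have hab' := (mem_filter.1 hp').2
    have he : blockArc n a b hab.1 = blockArc n a' b' hab'.1 := congrArg Subtype.val heq
    have haa : a = a' := by
      rw [← card_openers_blockArc n a b hab.1, ← card_openers_blockArc n a' b' hab'.1, he]
    subst haa
    have hbb : b = b' := by
      rcases Nat.eq_zero_or_pos a with rfl | ha
      · exact (hab.2 rfl : b = 0).trans (hab'.2 rfl : b' = 0).symm
      · have h1 := blockArc_zero_val n a b hab.1 ha
        rw [he, blockArc_zero_val n a b' hab'.1 ha] at h1
        omega
    subst hbb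
    rfl
  · rintro ⟨u, hinv, h4321, h132⟩
    obtain ⟨a, b, h, hab0, rfl⟩ := eq_blockArc ((mul_self_eq_one_iff_apply_apply u).1 hinv) h4321 h132
    refine ⟨⟨(a, b), mem_filter.2 ⟨mem_product.2 ⟨mem_range.2 (by omega), mem_range.2 (by omega)⟩, h, hab0⟩⟩, rfl⟩

/-- Reversal of the word `4321` is `1234`. [cite: BarnabeiBonettiSilimbani2011, Theorem 5 (i) (proof: `I_n(4321)` is closed under reverse-complement; arXiv 0812.0463)] -/
theorem rev_4321 : (![4, 3, 2, 1] : Fin 4 → ℕ) ∘ Fin.rev = ![1, 2, 3, 4] := funext fun a => by fin_cases a <;> rfl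

/-- Complement (in `5 − ·`) of the word `1234` is `4321`. [cite: BarnabeiBonettiSilimbani2011, Theorem 5 (i) (arXiv 0812.0463)] -/
theorem compl_1234 : (fun a => 5 - (![1, 2, 3, 4] : Fin 4 → ℕ) a) = ![4, 3, 2, 1] :=
  funext fun a => by fin_cases a <;> rfl

/-- `4321` is its own reverse-complement: `rev ∘ v ∘ rev` contains `4321` iff `v` does («the set `I_n(4321)` is closed
under reverse-complement»). [cite: BarnabeiBonettiSilimbani2011, Theorem 5 (i) (proof; arXiv 0812.0463)] -/
theorem reverseComplement_contains_4321_iff (v : Perm (Fin n)) :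
    PermContainsPattern (Fin.revPerm * v * Fin.revPerm) ![4, 3, 2, 1] ↔ PermContainsPattern v ![4, 3, 2, 1] := by
  rw [reverse_iff, rev_4321, complement_iff v (M := 5) (fun a => by fin_cases a <;> decide), compl_1234]

/-- ★★ **COROLLARY 6 (i), `p = 213`: `|I_n(4321, 213)| = 1 + ⌊n/2⌋·⌈n/2⌉`**, transported along the reverse-complement
(«the pattern `213` is the reverse-complement of `132` … the set `I_n(4321)` is closed under reverse-complement»).
[cite: BarnabeiBonettiSilimbani2011, Theorem 5 (i) and Corollary 6 (i) (arXiv 0812.0463)] -/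
theorem card_involutions_av4321_av213 (n : ℕ) :
    Nat.card {u : Perm (Fin n) // u * u = 1 ∧ ¬ PermContainsPattern u ![4, 3, 2, 1] ∧
      ¬ PermContainsPattern u ![2, 1, 3]} = 1 + (n / 2) * (n - n / 2) := by
  rw [← card_involutions_av4321_av132 n]
  refine Nat.card_congr (Equiv.subtypeEquiv
    { toFun := fun v => Fin.revPerm * v * Fin.revPerm
      invFun := fun v => Fin.revPerm * v * Fin.revPerm
      left_inv := fun v => by
        show Fin.revPerm * (Fin.revPerm * v * Fin.revPerm) * Fin.revPerm = v
        rw [← mul_assoc, ← mul_assoc, revPerm_mul_revPerm', one_mul, mul_assoc, revPerm_mul_revPerm', mul_one]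
      right_inv := fun v => by
        show Fin.revPerm * (Fin.revPerm * v * Fin.revPerm) * Fin.revPerm = v
        rw [← mul_assoc, ← mul_assoc, revPerm_mul_revPerm', one_mul, mul_assoc, revPerm_mul_revPerm', mul_one] }
    fun v => ?_)
  show _ ↔ Fin.revPerm * v * Fin.revPerm * (Fin.revPerm * v * Fin.revPerm) = 1 ∧
    ¬ PermContainsPattern (Fin.revPerm * v * Fin.revPerm) ![4, 3, 2, 1] ∧
      ¬ PermContainsPattern (Fin.revPerm * v * Fin.revPerm) ![1, 3, 2]
  rw [reverseComplement_mul_self_eq_one_iff, reverseComplement_contains_132_iff, reverseComplement_contains_4321_iff]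

/-- `|I_n(4321, 132)| = |I_n(4321, 213)|`. [cite: BarnabeiBonettiSilimbani2011, Corollary 6 (i) (arXiv 0812.0463)] -/
theorem card_involutions_av4321_av132_eq_av213 (n : ℕ) :
    Nat.card {u : Perm (Fin n) // u * u = 1 ∧ ¬ PermContainsPattern u ![4, 3, 2, 1] ∧
      ¬ PermContainsPattern u ![1, 3, 2]} =
      Nat.card {u : Perm (Fin n) // u * u = 1 ∧ ¬ PermContainsPattern u ![4, 3, 2, 1] ∧
        ¬ PermContainsPattern u ![2, 1, 3]} := by
  rw [card_involutions_av4321_av132, card_involutions_av4321_av213]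

/-- Values: `|I_n(4321,132)| = 1, 1, 2, 3, 5, 7, 10` for `n = 0, …, 6`. [cite: BarnabeiBonettiSilimbani2011, Corollary 6 (i) (arXiv 0812.0463)] -/
theorem card_involutions_av4321_av132_values :
    (List.range 7).map (fun n => Nat.card {u : Perm (Fin n) // u * u = 1 ∧ ¬ PermContainsPattern u ![4, 3, 2, 1] ∧
      ¬ PermContainsPattern u ![1, 3, 2]}) = [1, 1, 2, 3, 5, 7, 10] := by
  simp only [card_involutions_av4321_av132]
  decide

end PermContainsPattern

end Literature.Combinatorics.Enumerative
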